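import Summits.NavierStokesRegularity.NavierStokesRegularity.Theorems.TerminalTraceTypeITraceScarL3SqrtTwoApexEngine
import Summits.NavierStokesRegularity.NavierStokesRegularity.Theorems.TerminalTraceTypeITraceScarL3SqrtTwoApexPressureGauge
import Literature.Analysis.FluidPDE.TypeIRateClassicalRepresentative
import HarnessLib

/-!
# T27-A «THE √2 APEX» MODULO THE SHELL PRESSURE BUDGET (ROUND-27, item `TerminalTrace.TypeITraceScarL3`,
# stmt-NavierStokesRegularity-18385, Stub LOUD line; helper)

Seat nsreg-C26-p1 g2 (cell ns-regularity-ideate), `--supports stmt-NavierStokesRegularity-18385` (helper);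
planner-of-record nsreg-p2 g29 (ROUND-27 «THE √2 APEX», companion `R27-sqrt2-apex.lean` v2 1e24a2a485d38e8d:
T27-A `RateSqThreshold` l.128, the shell pressure target `target_shell_pressure_L1` l.213).

* **`rateSqThreshold_of_shellPressureBudget`** — IF the shell pressure budget of ROUND-27 holds (hypothesis
  `hSP`, = `target_shell_pressure_L1` with `ApexPackage`/`QuietShell` spelled out: for every extinct Type-I apex
  package that is quiet on a shell slab `]−δ,0[ × {R < |y| < AR}`, the pressure has, up to a time-dependent
  gauge `c(s)`, a uniform `L¹` bound on the middle third `{(2R+AR)/3 < |y| < (R+2AR)/3}` for a.e. late `s`), THEN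
  T27-A holds VERBATIM (`RateSqThreshold` spelled out): an extinct Type-I apex of class `(M, D₀, C)` that is
  backward singular at the origin and quiet on one shell slab of ANY ratio `A > 1` has `2 ≤ C²`.
  Proof: the classical representative below the top (`exists_classical_repr_of_apexPackage`, KNSS/ESŠ), the
  pressure gauge (`reprBudget_of_shellBudget`), and the engine `two_le_rateSq_of_quietShell_of_reprBudget`
  (cut-off energy/enstrophy identities, Ghidaglia's sharp inequality, the transported cubic floor at the singular
  origin, strong extinction, the frequency ODE).
With the conditional records of `…SqrtTwoApexWindow` (T27-B/C) and the constant-exposed Stub 2′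
(`extinctApexD_of_L3trace_const`), item 18385 for blow-ups with eventual Type-I constant `C² < 2ν` is thereby a
tree theorem MODULO `target_shell_pressure_L1` ALONE.

WHAT THIS IS NOT: not T27-A unconditionally (the shell pressure budget — a statement about the Riesz pressure of
a Morrey-bounded field on a quiet shell — is the one remaining hypothesis), not Stub LOUD, not item 18385, NOT a
proof of Navier–Stokes regularity.  [folklore; Ghidaglia 1986; Temam IDDS 1997 §III.6; Seregin2014 Prop. 6.20;
CaffarelliKohnNirenberg1982 Thm B; KochNadirashviliSereginSverak2009 §4]
-/

noncomputable section

set_option linter.dupNamespace false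

namespace Summit.NavierStokesRegularity.NavierStokesRegularity.Theorems.TypeITraceScarL3

open MeasureTheory Set Function Filter Topology Metric InnerProductSpace
open Literature.Analysis Literature.Analysis.FluidPDE
open scoped NNReal ENNReal RealInnerProductSpace ContDiff

/-- **T27-A modulo the shell pressure budget** (module docstring): `hSP` is ROUND-27's
`target_shell_pressure_L1` spelled out; the conclusion is `RateSqThreshold` spelled out.
[folklore; Ghidaglia 1986; Temam IDDS 1997 §III.6 L6.1; Seregin2014 Prop. 6.20; CaffarelliKohnNirenberg1982 Thm B] -/
theorem rateSqThreshold_of_shellPressureBudget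
    (hSP : ∀ (M D₀ : ℝ≥0) (C : ℝ)
      (U : ℝ → EuclideanSpace ℝ (Fin 3) → EuclideanSpace ℝ (Fin 3))
      (P : ℝ → EuclideanSpace ℝ (Fin 3) → ℝ)
      (G : ℝ → EuclideanSpace ℝ (Fin 3) →
        EuclideanSpace ℝ (Fin 3) →L[ℝ] EuclideanSpace ℝ (Fin 3)),
      (∀ a : ℝ, 0 < a →
        IsSuitableWeakSolutionInBall a (0 : ℝ × EuclideanSpace ℝ (Fin 3)) U P) →
      (∀ a : ℝ, 0 < a →
        HasWeakSpatialGradientOn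
          (parabolicCylinderOpens a (0 : ℝ × EuclideanSpace ℝ (Fin 3))) U G) →
      (∀ a : ℝ, 0 < a →
        typeIBound (parabolicCylinder a (0 : ℝ × EuclideanSpace ℝ (Fin 3))) U P G ≤ M) →
      (∀ z₀ : ℝ × EuclideanSpace ℝ (Fin 3), z₀.1 ≤ 0 →
        ∀ r : ℝ, 0 < r → cknD r z₀ P ≤ D₀) →
      (∀ s : ℝ, s < 0 →
        ∀ᵐ y : EuclideanSpace ℝ (Fin 3), ‖U s y‖ ≤ C / Real.sqrt (-s)) →
      (∀ φ : EuclideanSpace ℝ (Fin 3) → EuclideanSpace ℝ (Fin 3),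
        ContDiff ℝ (⊤ : ℕ∞) φ →
        HasCompactSupport φ → ∀ ε : ℝ, 0 < ε →
        ∃ s₀ : ℝ, s₀ < 0 ∧ ∀ᵐ s ∂(volume.restrict (Ioo s₀ 0)), |∫ y, ⟪U s y, φ y⟫| ≤ ε) →
      ∀ (A R δ K : ℝ), 1 < A → 0 < R → 0 < δ →
        (∀ᵐ z ∂(volume.restrict
          (Ioo (-δ) 0 ×ˢ {y : EuclideanSpace ℝ (Fin 3) | R < ‖y‖ ∧ ‖y‖ < A * R})),
            ‖U z.1 z.2‖ ≤ K) →
        ∃ (mP δ' : ℝ), 0 < δ' ∧ ∃ c : ℝ → ℝ,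
          ∀ᵐ s ∂(volume.restrict (Ioo (-δ') 0)),
            ∫⁻ y in {y : EuclideanSpace ℝ (Fin 3) |
                (2 * R + A * R) / 3 < ‖y‖ ∧ ‖y‖ < (R + 2 * A * R) / 3}, ‖P s y - c s‖ₑ ≤
              ENNReal.ofReal mP) :
    ∀ (M D₀ : ℝ≥0) (C : ℝ)
      (U : ℝ → EuclideanSpace ℝ (Fin 3) → EuclideanSpace ℝ (Fin 3))
      (P : ℝ → EuclideanSpace ℝ (Fin 3) → ℝ)
      (G : ℝ → EuclideanSpace ℝ (Fin 3) →
        EuclideanSpace ℝ (Fin 3) →L[ℝ] EuclideanSpace ℝ (Fin 3)),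
      (∀ a : ℝ, 0 < a →
        IsSuitableWeakSolutionInBall a (0 : ℝ × EuclideanSpace ℝ (Fin 3)) U P) →
      (∀ a : ℝ, 0 < a →
        HasWeakSpatialGradientOn
          (parabolicCylinderOpens a (0 : ℝ × EuclideanSpace ℝ (Fin 3))) U G) →
      (∀ a : ℝ, 0 < a →
        typeIBound (parabolicCylinder a (0 : ℝ × EuclideanSpace ℝ (Fin 3))) U P G ≤ M) →
      (∀ z₀ : ℝ × EuclideanSpace ℝ (Fin 3), z₀.1 ≤ 0 →
        ∀ r : ℝ, 0 < r → cknD r z₀ P ≤ D₀) →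
      (∀ s : ℝ, s < 0 →
        ∀ᵐ y : EuclideanSpace ℝ (Fin 3), ‖U s y‖ ≤ C / Real.sqrt (-s)) →
      (∀ φ : EuclideanSpace ℝ (Fin 3) → EuclideanSpace ℝ (Fin 3),
        ContDiff ℝ (⊤ : ℕ∞) φ →
        HasCompactSupport φ → ∀ ε : ℝ, 0 < ε →
        ∃ s₀ : ℝ, s₀ < 0 ∧ ∀ᵐ s ∂(volume.restrict (Ioo s₀ 0)), |∫ y, ⟪U s y, φ y⟫| ≤ ε) →
      IsBackwardSingularPoint U (0 : ℝ × EuclideanSpace ℝ (Fin 3)) →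
      ∀ (A R δ K : ℝ), 1 < A → 0 < R → 0 < δ →
        (∀ᵐ z ∂(volume.restrict
          (Ioo (-δ) 0 ×ˢ {y : EuclideanSpace ℝ (Fin 3) | R < ‖y‖ ∧ ‖y‖ < A * R})),
            ‖U z.1 z.2‖ ≤ K) →
        2 ≤ C ^ 2 := by
  intro M D₀ C U P G hsw hG hI hD hrate htop hsing A R δ K hA hR hδ hq
  -- the classical representative below the top
  obtain ⟨V, hUV, hVc, hdec, hsm, -, -, hwin, -⟩ := exists_classical_repr_of_apexPackage hsw hI hrate
  -- the shell pressure budget for this package and this quiet shell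
  obtain ⟨mP, δ', hδ', c, hP⟩ := hSP M D₀ C U P G hsw hG hI hD hrate htop A R δ K hA hR hδ hq
  have hP' : ∀ᵐ s ∂(volume.restrict (Ioo (-δ') 0)),
      ∫⁻ y in {y : EuclideanSpace ℝ (Fin 3) | (2 * R + A * R) / 3 < ‖y‖ ∧ ‖y‖ < (R + 2 * A * R) / 3},
        ‖P s y - c s‖ₑ ≤ ENNReal.ofReal (max mP 0) := by
    filter_upwards [hP] with s hs
    exact hs.trans (ENNReal.ofReal_le_ofReal (le_max_left _ _))
  -- the compact annulus inside the middle third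
  have hAR : R < A * R := by nlinarith
  have hKS : {y : EuclideanSpace ℝ (Fin 3) | (5 * R + 4 * (A * R)) / 9 ≤ ‖y‖ ∧ ‖y‖ ≤ (4 * R + 5 * (A * R)) / 9} ⊆
      {y : EuclideanSpace ℝ (Fin 3) | (2 * R + A * R) / 3 < ‖y‖ ∧ ‖y‖ < (R + 2 * A * R) / 3} := by
    intro y hy
    exact ⟨by linarith [hy.1], by linarith [hy.2]⟩
  have hKc : IsCompact {y : EuclideanSpace ℝ (Fin 3) |
      (5 * R + 4 * (A * R)) / 9 ≤ ‖y‖ ∧ ‖y‖ ≤ (4 * R + 5 * (A * R)) / 9} := isCompact_annulus _ _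
  -- the budget of every window pressure of the representative, at every late time
  have hbud := reprBudget_of_shellBudget hsw hUV hKc hKS (le_max_right mP 0) hP'
  -- the engine
  exact two_le_rateSq_of_quietShell_of_reprBudget hsw hG hI hD htop hsing hA hR hδ hq hUV hVc hsm
    (fun s hs y => hdec s hs y) hwin ⟨max mP 0 + 1, δ', hδ', hbud⟩

end Summit.NavierStokesRegularity.NavierStokesRegularity.Theorems.TypeITraceScarL3

end
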